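import Mathlib
import Literature.NumberTheory.GaloisRepresentations.SymplecticMultiplier
import Literature.NumberTheory.GaloisRepresentations.AbsGaloisOuterConj
import HarnessLib

/-!
# Stub `stub_restrictionIsPolarized` (line `Sketch`, crux `SerreGSp4Surjective`,
# stmt-Langlands-17765)

The polarisation of the restriction of a symplectic representation, as pure matrix algebra.

Let `r : Γ_ℚ →ₜ* GL₄(A)` be symplectic with multiplier function `ν`
(`FramedGaloisRep.IsSymplecticWithMultiplierFun`: `r(g)ᵀ J r(g) = ν(g) • J` for an alternating `J`
with unit determinant), let `K/ℚ` be a Galois number field, `res : Γ_K → Γ_ℚ` the fixed restriction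
(`absGaloisRestrict ℚ K`) and `θ_τ` the outer action of `τ ∈ Γ_ℚ` on `Γ_K`
(`absGaloisOuterConj`, `res (θ_τ σ) = τ res(σ) τ⁻¹`).  Then the conjugate `(r|_K)^τ = r|_K ∘ θ_τ`
(`FramedGaloisRep.outerConj`) is, in the FIXED frame `g = r(τ) J⁻¹` (depending on `τ` only),
the `ν`-twist of the dual of `r|_K`:

`(r|_K)^τ (σ) = r(τ) r(res σ) r(τ)⁻¹ = ν(res σ) • g (r(res σ)⁻¹)ᵀ g⁻¹`.

Indeed from `Mᵀ J M = c • J` with `M = r(res σ)` invertible one gets `J M = c • (M⁻¹)ᵀ J`, hence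
`M = c • J⁻¹ (M⁻¹)ᵀ J`, and conjugating by `r(τ)` gives the claim
(`conj_eq_smul_frame_transpose_inv`).  This is the polarisation `(r|_K)^τ ≅ ν ⊗ (r|_K)^∨` consumed
by the unitary-type lifting theorems in the level-induction step of the line.
-/

set_option linter.dupNamespace false -- `Summit.Langlands.Langlands` is the mandated namespace

namespace Summit.Langlands.Langlands.Cruxes.SerreGSp4Surjective.Sketch

open Literature.NumberTheory.GaloisRepresentations
open Matrix

/-- Matrix algebra behind the polarisation: if `Mᵀ J M = c • J` with `M Mi = 1` and `Ji J = 1`,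
then for ANY `P`, `Pi`, `P M Pi = c • (P Ji) Miᵀ (J Pi)`. -/
private theorem conj_eq_smul_frame_transpose_inv {A : Type*} [CommRing A] {n : Type*} [Fintype n]
    [DecidableEq n] (P Pi M Mi J Ji : Matrix n n A) (c : A) (hM : M * Mi = 1) (hJ : Ji * J = 1)
    (h : Mᵀ * J * M = c • J) :
    P * M * Pi = c • (P * Ji * Miᵀ * (J * Pi)) := by
  have h1 : J * M = c • (Miᵀ * J) := by
    calc J * M = (M * Mi)ᵀ * J * M := by rw [hM, transpose_one, Matrix.one_mul]
      _ = Miᵀ * (Mᵀ * J * M) := by rw [transpose_mul]; simp only [Matrix.mul_assoc]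
      _ = c • (Miᵀ * J) := by rw [h, Matrix.mul_smul]
  have h2 : M = c • (Ji * (Miᵀ * J)) := by
    calc M = Ji * (J * M) := by rw [← Matrix.mul_assoc, hJ, Matrix.one_mul]
      _ = c • (Ji * (Miᵀ * J)) := by rw [h1, Matrix.mul_smul]
  rw [h2]
  simp only [Matrix.mul_smul, Matrix.smul_mul, Matrix.mul_assoc]

/-- **Restriction of a symplectic representation is polarised.** For `r : Γ_ℚ →ₜ* GL₄(A)`
symplectic with multiplier `ν`, a Galois number field `K/ℚ` and `τ ∈ Γ_ℚ`, the frame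
`g = r(τ) J⁻¹` conjugates `(r|_K)^τ` into `ν ∘ res ⊗ ((r|_K)⁻¹)ᵀ`:
`(r|_K)^τ(σ) = ν(res σ) • g (r|_K(σ)⁻¹)ᵀ g⁻¹` for all `σ ∈ Γ_K`. -/
theorem stub_restrictionIsPolarized :
    ∀ (A : Type) [CommRing A] [TopologicalSpace A] [IsTopologicalRing A]
      (K : Type) [Field K] [NumberField K] [IsGalois ℚ K]
      (r : FramedGaloisRep ℚ A 4) (ν : Field.absoluteGaloisGroup ℚ → A),
      r.IsSymplecticWithMultiplierFun ν →
      ∀ τ : Field.absoluteGaloisGroup ℚ, ∃ g : GL (Fin 4) A, ∀ σ : Field.absoluteGaloisGroup K,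
        ((r.restrictField K).outerConj τ σ).val =
          ν (absGaloisRestrict ℚ K σ) •
            (g.val * ((r.restrictField K σ)⁻¹).val.transpose * (g⁻¹).val) := by
  intro A _ _ _ K _ _ _ r ν hr τ
  obtain ⟨J, _, hJdet, hJ⟩ := hr
  have hJu : IsUnit J := (Matrix.isUnit_iff_isUnit_det J).mpr hJdet
  refine ⟨r τ * hJu.unit⁻¹, fun σ => ?_⟩
  simp only [FramedGaloisRep.outerConj_apply, FramedGaloisRep.restrictField_apply,
    absGaloisRestrict_absGaloisOuterConj, map_mul, map_inv, _root_.mul_inv_rev, inv_inv,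
    Units.val_mul, IsUnit.unit_spec]
  exact conj_eq_smul_frame_transpose_inv _ _ _ _ _ _ _ (Units.mul_inv _) hJu.val_inv_mul (hJ _)

end Summit.Langlands.Langlands.Cruxes.SerreGSp4Surjective.Sketch
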